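import Summits.Parity.GeneralizedHardyLittlewood.Theorems.GreenTaoLevelTwoMNTwoVerticalOfLemma24
import Summits.Parity.GeneralizedHardyLittlewood.Theorems.GreenTaoLevelTwoMNTwoLemma24PolySmall
import Summits.Parity.GeneralizedHardyLittlewood.Theorems.GreenTaoLevelTwoMNTwoBohrFourier

/-!
# Route `GreenTaoLevelTwo`, crux `MNTwo` (stmt-Parity-21276), line `birth`: the stub
# `stub_mnVertical` — Möbius orthogonality for vertical characters on the Heisenberg class, BY NAME

The registered XL stub of the `MNTwo` birth skeleton (`Cruxes/MNTwo/Lines/birth.lean`), with its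
signature verbatim: for every box-comparable Def-8.1 metric `d`, every `X` in the Heisenberg class
of `H_d`, every `m` and every `A > 0` there are `C, B` with
`|∑_{n ≤ N} μ(n) F(gⁿx)| ≤ C M^B N / log^A N` for all `N ≥ 2`, `g`, `x` and all pairs
`F = F₁ + iF₂` of `1`-bounded `M`-Lipschitz functions on `X^m × ℝ/ℤ` transforming under the centre
by a character (B. Green, T. Tao, *Quadratic uniformity of the Möbius function*, Ann. Inst. Fourier
58 (2008) = arXiv:math/0606087, Thm. 1.1; *The Möbius function is strongly orthogonal to
nilsequences*, Ann. of Math. 175 (2012), Thm. 1.1 at `s = 2`).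

Proof = composition of the landed chain of this directory (`…MNTwo*`, 120+ files: bracket-quadratic
reduction, §§8–12 of AIF, the type I / type II dichotomy, Lemma 24 in polynomial form) through
`…MNTwoVerticalOfLemma24.stub_mnVertical_of_lemma24`, with the last input — the Fourier expansion of
Bohr-gauge Lipschitz cutoffs (AIF App. A Lemma 37) — supplied by
`…MNTwoBohrFourier.hfour_small` via `…MNTwoLemma24PolySmall.lemma24_poly_small` (the restricted,
true form of the expansion hypothesis; the unrestricted form consumed by `…MNTwoLemma24Poly` /
`…MNTwoVerticalOfFourier` is false and is not used).  Ineffective `C` (Siegel), as registered.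

* `stub_mnVertical` — the registered signature, proved.

References: [GreenTao2008QuadraticMobius] Thm. 1.1, §§2–12, App. A; [GreenTao2012Mobius] Thm. 1.1.
-/

noncomputable section

open Literature.NumberTheory.Sieve
open Literature.NumberTheory.Sieve.GreenTaoLevelTwo (HX IsCompatMetric IsBoxComparable heisenbergWith
  InHeisClass)

namespace Summit.Parity.GeneralizedHardyLittlewood.GreenTaoLevelTwoMNTwoMnVerticalStub

open Summit.Parity.GeneralizedHardyLittlewood.GreenTaoLevelTwoMNTwoVerticalOfLemma24
  (stub_mnVertical_of_lemma24)
open Summit.Parity.GeneralizedHardyLittlewood.GreenTaoLevelTwoMNTwoLemma24PolySmall (lemma24_poly_small)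
open Summit.Parity.GeneralizedHardyLittlewood.GreenTaoLevelTwoMNTwoBohrFourier (hfour_small)

/-- **Stub `stub_mnVertical` of crux `MNTwo` (line `birth`), by name**: Möbius is orthogonal to
vertical-character `2`-step nilsequences on the Heisenberg class, with polynomial dependence on the
Lipschitz constant (registered signature verbatim).
[cite: GreenTao2008QuadraticMobius, Thm. 1.1] [cite: GreenTao2012Mobius, Thm. 1.1] -/
theorem stub_mnVertical :
    (∀ (d : HX → HX → ℝ) (h : IsCompatMetric d), IsBoxComparable d →
      ∀ X : Nilmanifold 2, InHeisClass (heisenbergWith d h) X → ∀ m : ℕ,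
        ∀ A : ℝ, 0 < A → ∃ C B : ℝ, ∀ M : ℝ, 1 ≤ M → ∀ N : ℕ, 2 ≤ N →
          ∀ (g : ((X.pow m).prod (Nilmanifold.circle.ofLE one_le_two)).G) (x : ((X.pow m).prod (Nilmanifold.circle.ofLE one_le_two)).G ⧸ ((X.pow m).prod (Nilmanifold.circle.ofLE one_le_two)).Γ) (F₁ F₂ : ((X.pow m).prod (Nilmanifold.circle.ofLE one_le_two)).G ⧸ ((X.pow m).prod (Nilmanifold.circle.ofLE one_le_two)).Γ → ℝ),
            ((X.pow m).prod (Nilmanifold.circle.ofLE one_le_two)).IsBoundedLipschitz M F₁ → ((X.pow m).prod (Nilmanifold.circle.ofLE one_le_two)).IsBoundedLipschitz M F₂ →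
            (∃ θ : ((X.pow m).prod (Nilmanifold.circle.ofLE one_le_two)).G → ℝ, ∀ z : ((X.pow m).prod (Nilmanifold.circle.ofLE one_le_two)).G, z ∈ Subgroup.center ((X.pow m).prod (Nilmanifold.circle.ofLE one_le_two)).G →
              ∀ x : ((X.pow m).prod (Nilmanifold.circle.ofLE one_le_two)).G ⧸ ((X.pow m).prod (Nilmanifold.circle.ofLE one_le_two)).Γ,
                ((F₁ (z • x) : ℂ) + (F₂ (z • x) : ℂ) * Complex.I) =
                  Complex.exp (2 * Real.pi * Complex.I * θ z) * ((F₁ x : ℂ) + (F₂ x : ℂ) * Complex.I)) →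
              ‖∑ n ∈ Finset.Icc 1 N, ((ArithmeticFunction.moebius n : ℝ) : ℂ) *
                  ((F₁ (g ^ n • x) : ℂ) + (F₂ (g ^ n • x) : ℂ) * Complex.I)‖ ≤
                C * M ^ B * N / Real.log N ^ A) :=
  stub_mnVertical_of_lemma24 fun k => lemma24_poly_small k (hfour_small k)

end Summit.Parity.GeneralizedHardyLittlewood.GreenTaoLevelTwoMNTwoMnVerticalStub
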